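import Summits.AnomalousDissipation.AnomalousDissipation.Theorems.TwoAndHalfDScalarLift2halfDRGalerkinTools

/-!
# Route TwoAndHalfD (AnomalousDissipation) — time derivatives along a Hopf–Galerkin scheme and
# planar sections of space–time fields (support of item `ScalarLift2halfDR`,
# stmt-AnomalousDissipation-14983)

Helper file (everything proved), continuing `TwoAndHalfDScalarLift2halfDRGalerkinTools`:

* along any Hopf–Galerkin scheme (`Literature.Analysis.FluidPDE.IsHopfGalerkinScheme`, any
  dimension) the dissipation and the work are continuous in time on `[0, ∞)`, the kinetic energy
  is differentiable at every `t₀ > 0` with derivative `-ν‖∇U n t₀‖₂² + ⟪F n t₀, U n t₀⟫`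
  (`schemeKineticEnergy_hasDerivAt`, FTC on the clause `energy_eq`), and `t ↦ ‖U n t - U n t₀‖₂²`
  has derivative `0` at `t₀` (`schemeSqDist_hasDerivAt_zero`: expand the square and differentiate
  the Galerkin pairing with the mode `U n t₀`);
* planar and vertical sections of space–time fields on `𝕋³`: continuity and smoothness of the
  space–time lifts (`continuousOn_stLift_planarPart`, `contDiff_stLift_planarPart`, …).

References: Hopf 1951 §§2–4; Robinson–Rodrigo–Sadowski 2016, Thm. 4.4.
-/

noncomputable section

open MeasureTheory Set Filter Topology Function UnitAddTorus
open scoped ENNReal NNReal InnerProductSpace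
open Literature.Analysis.FunctionSpaces Literature.Analysis.FunctionSpaces.Torus
open Literature.Analysis.FluidPDE Literature.Analysis.FluidPDE.Torus

namespace Summit.AnomalousDissipation.AnomalousDissipation.Theorems

-- D-0017: single-problem summit ⇒ `Summit.AnomalousDissipation.AnomalousDissipation.…` by design.
set_option linter.dupNamespace false

/-! ## Time derivatives along a Hopf–Galerkin scheme (any dimension) -/

section SchemeDeriv

variable {d : Type*} [Fintype d] [DecidableEq d]
variable {ν : ℝ} {f : ℝ → UnitAddTorus d → EuclideanSpace ℝ d} {u₀ : UnitAddTorus d → EuclideanSpace ℝ d}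
  {N : ℕ → ℕ} {F U : ℕ → ℝ → UnitAddTorus d → EuclideanSpace ℝ d}

/-- The dissipation of the Galerkin approximations is continuous in time on `[0, ∞)`. [folklore] -/
theorem schemeDissipation_continuousOn (hS : IsHopfGalerkinScheme ν f u₀ N F U) (n : ℕ) :
    ContinuousOn (fun t => (eGradNormSq (U n t)).toReal) (Ici 0) :=
  continuousOn_toReal_eGradNormSq_of_band_limited (hS.continuousOn n)
    fun t ht _ hk => (hS.isGalerkinMode n t ht).mFourierCoeff_eq_zero hk

/-- The dissipation of the Galerkin approximations is finite at every `t ≥ 0`. [folklore] -/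
theorem schemeDissipation_ne_top (hS : IsHopfGalerkinScheme ν f u₀ N F U) (n : ℕ) {t : ℝ} (ht : 0 ≤ t) :
    eGradNormSq (U n t) ≠ ⊤ :=
  (eGradNormSq_lt_top (hS.isGalerkinMode n t ht).isSmooth).ne

/-- The work of the approximate force is continuous in time on `[0, ∞)`. [folklore] -/
theorem schemeWork_continuousOn (hS : IsHopfGalerkinScheme ν f u₀ N F U) (n : ℕ) :
    ContinuousOn (fun t => ∫ x, ⟪F n t x, U n t x⟫_ℝ) (Ici 0) :=
  continuousOn_integral_inner_of_continuousOn_stLift (hS.continuousOn_force n) (hS.continuousOn n)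

/-- **The kinetic energy of a Galerkin approximation is differentiable at every `t₀ > 0`**, with
derivative `-ν‖∇U n t₀‖₂² + ∫⟪F n t₀, U n t₀⟫` (FTC on the clause `energy_eq`, whose integrands
are continuous in time). [folklore] -/
theorem schemeKineticEnergy_hasDerivAt (hS : IsHopfGalerkinScheme ν f u₀ N F U) (n : ℕ) {t₀ : ℝ}
    (ht₀ : 0 < t₀) :
    HasDerivAt (fun t => kineticEnergy (U n t))
      (-(ν * (eGradNormSq (U n t₀)).toReal) + ∫ x, ⟪F n t₀ x, U n t₀ x⟫_ℝ) t₀ := by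
  set e : ℝ → ℝ := fun τ => -(ν * (eGradNormSq (U n τ)).toReal) + ∫ x, ⟪F n τ x, U n τ x⟫_ℝ with he
  have hDc := schemeDissipation_continuousOn hS n
  have hWc := schemeWork_continuousOn hS n
  have hecont : ContinuousOn e (Ici 0) := ((continuousOn_const.mul hDc).neg).add hWc
  have hecontI : ContinuousOn e (Ioi 0) := hecont.mono Ioi_subset_Ici_self
  have hprim : HasDerivAt (fun s => ∫ τ in (0 : ℝ)..s, e τ) (e t₀) t₀ := by
    refine intervalIntegral.integral_hasDerivAt_right ?_ ?_ ?_
    · exact (hecont.mono Icc_subset_Ici_self).intervalIntegrable_of_Icc ht₀.le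
    · exact hecontI.stronglyMeasurableAtFilter isOpen_Ioi t₀ ht₀
    · exact hecontI.continuousAt (Ioi_mem_nhds ht₀)
  have heq : (fun t => kineticEnergy (U n t)) =ᶠ[𝓝 t₀]
      fun t => kineticEnergy (U n 0) + ∫ τ in (0 : ℝ)..t, e τ := by
    filter_upwards [Ioi_mem_nhds ht₀] with t ht
    have ht' : (0 : ℝ) ≤ t := le_of_lt ht
    have hE := hS.energy_eq n 0 t le_rfl ht'
    rw [toReal_setLIntegral_eq_intervalIntegral (D := fun τ => eGradNormSq (U n τ)) ht'
      (fun τ hτ => schemeDissipation_ne_top hS n hτ.1) (hDc.mono Icc_subset_Ici_self)] at hE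
    have hI : ∀ {φ : ℝ → ℝ}, ContinuousOn φ (Ici 0) → IntervalIntegrable φ volume 0 t :=
      fun hφ => (hφ.mono Icc_subset_Ici_self).intervalIntegrable_of_Icc ht'
    have hsplit : ∫ τ in (0 : ℝ)..t, e τ =
        -(ν * ∫ τ in (0 : ℝ)..t, (eGradNormSq (U n τ)).toReal) + ∫ τ in (0 : ℝ)..t, ∫ x, ⟪F n τ x, U n τ x⟫_ℝ := by
      have iD : IntervalIntegrable (fun τ => -(ν * (eGradNormSq (U n τ)).toReal)) volume 0 t :=
        hI (φ := fun τ => -(ν * (eGradNormSq (U n τ)).toReal)) ((continuousOn_const.mul hDc).neg)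
      have iW : IntervalIntegrable (fun τ => ∫ x, ⟪F n τ x, U n τ x⟫_ℝ) volume 0 t := hI hWc
      simp only [he]
      rw [intervalIntegral.integral_add iD iW, intervalIntegral.integral_neg, intervalIntegral.integral_const_mul]
    rw [hsplit]
    linarith
  exact (hprim.const_add _).congr_of_eventuallyEq heq

/-- **The squared `L²` distance to a fixed slice vanishes to second order**: for `t₀ > 0`,
`t ↦ ∫‖U n t - U n t₀‖²` has derivative `0` at `t₀` (expand the square: twice the kinetic energy,
minus twice the Galerkin pairing with the mode `U n t₀`, whose derivatives at `t₀` coincide). [folklore] -/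
theorem schemeSqDist_hasDerivAt_zero (hS : IsHopfGalerkinScheme ν f u₀ N F U) (n : ℕ) {t₀ : ℝ}
    (ht₀ : 0 < t₀) :
    HasDerivAt (fun t => ∫ x, ‖U n t x - U n t₀ x‖ ^ 2) 0 t₀ := by
  have hmode := hS.isGalerkinMode n t₀ ht₀.le
  have hP := hS.hasDerivAt_galerkin_pairing n hmode ht₀
  have hRHS := integral_galerkin_rhs_self hmode.isSmooth hmode.isDivFree (hS.continuous_force_slice n ht₀.le) ν
  have hE := schemeKineticEnergy_hasDerivAt hS n ht₀
  have hc₀ : Continuous (U n t₀) := hS.continuous_slice n ht₀.le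
  -- expansion of the square for `t ≥ 0`
  have hexp : (fun t => ∫ x, ‖U n t x - U n t₀ x‖ ^ 2) =ᶠ[𝓝 t₀]
      fun t => 2 * kineticEnergy (U n t) - 2 * (∫ x, ⟪U n t x, U n t₀ x⟫_ℝ) + 2 * kineticEnergy (U n t₀) := by
    filter_upwards [Ioi_mem_nhds ht₀] with t ht
    have hct : Continuous (U n t) := hS.continuous_slice n (le_of_lt ht)
    have i1 : Integrable (fun x => ‖U n t x‖ ^ 2) volume := (hct.norm.pow 2).integrable_unitAddTorus
    have i2 : Integrable (fun x => 2 * ⟪U n t x, U n t₀ x⟫_ℝ) volume :=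
      ((hct.inner hc₀).integrable_unitAddTorus).const_mul 2
    have i3 : Integrable (fun x => ‖U n t₀ x‖ ^ 2) volume := (hc₀.norm.pow 2).integrable_unitAddTorus
    have i12 : Integrable (fun x => ‖U n t x‖ ^ 2 - 2 * ⟪U n t x, U n t₀ x⟫_ℝ) volume := i1.sub i2
    have hpt : (fun x => ‖U n t x - U n t₀ x‖ ^ 2) =
        fun x => ‖U n t x‖ ^ 2 - 2 * ⟪U n t x, U n t₀ x⟫_ℝ + ‖U n t₀ x‖ ^ 2 := by
      funext x
      rw [norm_sub_sq_real]
    simp only [kineticEnergy]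
    rw [hpt, integral_add i12 i3, integral_sub i1 i2, integral_const_mul]
    ring
  have hd : HasDerivAt
      (fun t => 2 * kineticEnergy (U n t) - 2 * (∫ x, ⟪U n t x, U n t₀ x⟫_ℝ) + 2 * kineticEnergy (U n t₀))
      (2 * (-(ν * (eGradNormSq (U n t₀)).toReal) + ∫ x, ⟪F n t₀ x, U n t₀ x⟫_ℝ) -
        2 * (∫ x, (⟪U n t₀ x, Torus.convect (U n t₀) (U n t₀) x⟫_ℝ +
          ν * ⟪U n t₀ x, Torus.laplacian (U n t₀) x⟫_ℝ + ⟪F n t₀ x, U n t₀ x⟫_ℝ))) t₀ :=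
    ((hE.const_mul 2).sub (hP.const_mul 2)).add_const _
  rw [hRHS, sub_self] at hd
  exact hd.congr_of_eventuallyEq hexp

end SchemeDeriv

/-! ## Planar and vertical sections of space–time fields on `T³` -/

section PlanarSection

/-- The planar section map `σ : T² → T³`, `y ↦ (y, 0)`, is continuous. [folklore] -/
theorem continuous_planarSect : Continuous (planarSect : (UnitAddTorus (Fin 2)) → (UnitAddTorus (Fin 3))) := by
  refine continuous_pi fun i => ?_
  refine Fin.lastCases ?_ (fun j => ?_) i
  · simp only [planarSect_apply_last]
    exact continuous_const
  · simp only [planarSect_apply_castSucc]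
    exact continuous_apply j

variable {W : ℝ → (UnitAddTorus (Fin 3)) → (EuclideanSpace ℝ (Fin 3))} {S : Set ℝ}

/-- The space–time lift of the planar part of the planar section of a space–time field. [folklore] -/
theorem stLift_planarPart (W : ℝ → (UnitAddTorus (Fin 3)) → (EuclideanSpace ℝ (Fin 3))) :
    stLift (fun t y => planarProjE (W t (planarSect y))) =
      planarProjE ∘ (stLift W ∘ fun p : ℝ × (EuclideanSpace ℝ (Fin 2)) => (p.1, planarEmbed (p.2, 0))) := by
  rw [← stLift_comp_planarSect W]
  rfl

/-- The space–time lift of the vertical part of the planar section of a space–time field. [folklore] -/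
theorem stLift_verticalPart (W : ℝ → (UnitAddTorus (Fin 3)) → (EuclideanSpace ℝ (Fin 3))) :
    stLift (fun t y => W t (planarSect y) 2) =
      (EuclideanSpace.proj (2 : Fin 3) : (EuclideanSpace ℝ (Fin 3)) →L[ℝ] ℝ) ∘ (stLift W ∘ fun p : ℝ × (EuclideanSpace ℝ (Fin 2)) => (p.1, planarEmbed (p.2, 0))) := by
  rw [← stLift_comp_planarSect W]
  rfl

/-- Continuity of the space–time lift passes to the planar part of the planar section. [folklore] -/
theorem continuousOn_stLift_planarPart (hW : ContinuousOn (stLift W) (S ×ˢ univ)) :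
    ContinuousOn (stLift fun t y => planarProjE (W t (planarSect y))) (S ×ˢ univ) := by
  rw [stLift_planarPart]
  refine planarProjE.continuous.comp_continuousOn (hW.comp ?_ ?_)
  · exact (continuous_fst.prodMk (planarEmbed.continuous.comp (continuous_snd.prodMk continuous_const))).continuousOn
  · intro p hp
    exact ⟨hp.1, mem_univ _⟩

/-- Continuity of the space–time lift passes to the vertical part of the planar section. [folklore] -/
theorem continuousOn_stLift_verticalPart (hW : ContinuousOn (stLift W) (S ×ˢ univ)) :
    ContinuousOn (stLift fun t y => W t (planarSect y) 2) (S ×ˢ univ) := by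
  rw [stLift_verticalPart]
  refine (EuclideanSpace.proj (2 : Fin 3) : (EuclideanSpace ℝ (Fin 3)) →L[ℝ] ℝ).continuous.comp_continuousOn (hW.comp ?_ ?_)
  · exact (continuous_fst.prodMk (planarEmbed.continuous.comp (continuous_snd.prodMk continuous_const))).continuousOn
  · intro p hp
    exact ⟨hp.1, mem_univ _⟩

/-- Smoothness of the space–time lift passes to the planar part of the planar section. [folklore] -/
theorem contDiff_stLift_planarPart {n : WithTop ℕ∞} (hW : ContDiff ℝ n (stLift W)) :
    ContDiff ℝ n (stLift fun t y => planarProjE (W t (planarSect y))) := by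
  rw [stLift_planarPart]
  exact planarProjE.contDiff.comp
    (hW.comp (contDiff_fst.prodMk (planarEmbed.contDiff.comp (contDiff_snd.prodMk contDiff_const))))

end PlanarSection

end Summit.AnomalousDissipation.AnomalousDissipation.Theorems

end
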